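import Literature.Analysis.ODE.AnalyticFlowDomain
import Literature.Analysis.ODE.ParametricLinear
import HarnessLib

/-!
# Linear differential equations depending on parameters: the real-analytic (and `C^n`, `n : ℕ∞ω`)
# case of joint regularity in time and parameter

Topic `Analysis/ODE`. The sibling `ParametricLinear.lean` proves Lang's Prop. IV.1.9 / Thm. IV.1.16
(*Differential and Riemannian Manifolds* (1995), Ch. IV §1) for linear equations
`u' = A(p, t) u` with coefficient of class `C^n`, `n : ℕ∞` (`1 ≤ n ≤ ∞`): global solutions,
`C^n` jointly in `(p, t)` (`Literature.Analysis.ODE.exists_contDiffOn_linearODE_param`). Its proof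
only uses the smoothness of flows on their domain (`contDiffOn_flow_of_hasDerivAt`), which
`AnalyticFlowDomain.lean` has since extended VERBATIM to every `n : ℕ∞ω`
(`contDiffOn_flow_of_hasDerivAt_withTop`, whose case `n = ω` is the Cauchy–Poincaré theorem on
analytic dependence of solutions on initial conditions, Lang loc. cit. Thm. 1.14/1.16 read at
`p = ω`). This file repeats the statement and proof of `exists_contDiffOn_linearODE_param`
VERBATIM for `n : ℕ∞ω`, so that it applies to real-analytic coefficients:

* `exists_contDiffOn_linearODE_param_withTop` — for `A : P → ℝ → L(W, W)` of class `C^n`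
  (`n : ℕ∞ω`, `1 ≤ n`) on `U × (-T, T)`, every `T' < T` and `w₀ : W`, a family `u : P → ℝ → W` with
  `u p 0 = w₀`, `∂ₜ u p t = A p t (u p t)` (`p ∈ U`, `|t| < T'`) and `(p, t) ↦ u p t` of class `C^n`
  on `U × (-T', T')`;
* `exists_analyticOnNhd_linearODE_param` — the case `n = ω` spelled out with `AnalyticOnNhd`:
  **solutions of a linear equation whose coefficient is real-analytic jointly in time and
  parameter are real-analytic jointly in time and parameter** (classically Poincaré's theorem on
  analytic dependence on parameters, here for linear systems; Lang loc. cit., Thm. 1.14 and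
  Thm. 1.16, whose statements cover `p = ω`).

Needed by the analytic-continuation theorem for Killing vector fields (Nomizu 1960; file
`Literature/Geometry/Lorentzian/KillingChartAnalyticExtension.lean`), where the Killing transport
system along the rays of an analytic chart has to be solved analytically in the endpoint.
Everything is proved; no definitions, no named facts (D-0026).

## References

* S. Lang, *Differential and Riemannian Manifolds*, GTM 160 (1995), Ch. IV §1, Prop. 1.9,
  Thm. 1.14, Thm. 1.16 (held: `book:lang1995-differential-riemannian-manifolds`). [Lang1995]
* P. Hartman, *Ordinary Differential Equations*, SIAM Classics 38 (2002), Ch. IV §1, Lemma 1.1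
  (global existence for linear systems), Ch. V, Thm. 4.1 (dependence on parameters). [Hartman2002]
-/

noncomputable section

open Set Metric Filter Topology Function
open scoped ContDiff NNReal

namespace Literature.Analysis.ODE

universe u

section Linear

variable {P : Type u} [NormedAddCommGroup P] [NormedSpace ℝ P]
  {W : Type u} [NormedAddCommGroup W] [NormedSpace ℝ W] [CompleteSpace W]

/-- **Linear equations depending on parameters: global solutions, `C^n` jointly in time and
parameter, for every `n : ℕ∞ω` with `1 ≤ n`** — in particular for real-analytic coefficients
(`n = ω`). Let `A : P → ℝ → L(W, W)` be such that `(p, t) ↦ A p t` is `C^n` on `U × (-T, T)`, `U`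
open. Then for every `0 < T' < T` and `w₀ : W` there is `u : P → ℝ → W` with `u p 0 = w₀`,
`∂ₜ u p t = A p t (u p t)` for `p ∈ U`, `t ∈ (-T', T')`, and `(p, t) ↦ u p t` of class `C^n` on
`U × (-T', T')`. Proof verbatim that of `exists_contDiffOn_linearODE_param` (Lang 1995, Ch. IV §1,
Prop. 1.9 with the reformulation following Thm. 1.11, and Thm. 1.16): the curves
`s ↦ (p, τ₀ + s, v(τ₀ + s))`, `v` the global solution of the linear equation through `(τ₀, w)`
(`exists_solution_linear_Ioo`), are integral curves of the autonomous `C^n` field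
`(p, τ, w) ↦ (0, 1, A p τ w)`, hence jointly `C^n` in the initial point and `s` by
`contDiffOn_flow_of_hasDerivAt_withTop`. [cite: Lang1995, Ch. IV §1, Prop. 1.9 and Thm. 1.16] -/
theorem exists_contDiffOn_linearODE_param_withTop [CompleteSpace P] {n : ℕ∞ω} (hn : 1 ≤ n)
    {A : P → ℝ → W →L[ℝ] W} {U : Set P} (hU : IsOpen U) {T T' : ℝ} (hT' : 0 < T')
    (hTT : T' < T) (hA : ContDiffOn ℝ n (fun q : P × ℝ ↦ A q.1 q.2) (U ×ˢ Ioo (-T) T))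
    (w₀ : W) :
    ∃ u : P → ℝ → W, (∀ p ∈ U, u p 0 = w₀) ∧
      (∀ p ∈ U, ∀ t ∈ Ioo (-T') T', HasDerivAt (u p) (A p t (u p t)) t) ∧
      ContDiffOn ℝ n (fun q : P × ℝ ↦ u q.1 q.2) (U ×ˢ Ioo (-T') T') := by
  -- times: initial clocks `|τ₀| < δ`, curve parameters `|s| < T'`, clocks stay in `(-S, S) ⊆ (-T, T)`
  set δ : ℝ := (T - T') / 2 with hδ
  have hδ0 : 0 < δ := by rw [hδ]; linarith
  set S : ℝ := T' + δ with hS_def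
  have hS0 : 0 ≤ S := by rw [hS_def]; linarith
  have hST : S < T := by rw [hS_def, hδ]; linarith
  -- global solutions of the linear equations, for `p ∈ U`, through every `(τ₀, w)`
  have hcont : ∀ p ∈ U, ContinuousOn (A p) (Icc (-S) S) := fun p hp ↦ by
    have h1 : ContinuousOn (fun q : P × ℝ ↦ A q.1 q.2) (U ×ˢ Ioo (-T) T) := hA.continuousOn
    have h2 : ContinuousOn (fun t : ℝ ↦ ((p, t) : P × ℝ)) (Icc (-S) S) :=
      (continuous_const.prodMk continuous_id).continuousOn
    exact h1.comp h2 fun t ht ↦ ⟨hp, by constructor <;> linarith [ht.1, ht.2]⟩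
  have hsol : ∀ p ∈ U, ∀ τ₀ : ℝ, ∀ w : W, ∃ v : ℝ → W, v τ₀ = w ∧
      ∀ t ∈ Ioo (-S) S, HasDerivAt v (A p t (v t)) t := fun p hp τ₀ w ↦
    exists_solution_linear_Ioo hS0 (hcont p hp) τ₀ w
  choose! v hv0 hv using hsol
  -- the autonomous field on `Z = P × ℝ × W` and its integral curves
  set f : P × ℝ × W → P × ℝ × W := fun z ↦ (0, 1, A z.1 z.2.1 z.2.2) with hf_def
  set Uz : Set (P × ℝ × W) := U ×ˢ (Ioo (-T) T ×ˢ univ) with hUz_def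
  have hUz : IsOpen Uz := hU.prod (isOpen_Ioo.prod isOpen_univ)
  have hf : ContDiffOn ℝ n f Uz := by
    have hA' : ContDiffOn ℝ n (fun z : P × ℝ × W ↦ A z.1 z.2.1) Uz := by
      refine hA.comp (contDiffOn_fst.prodMk (contDiffOn_fst.comp contDiffOn_snd
        (fun z _ ↦ mem_univ _))) ?_
      rintro z ⟨hz1, hz2, -⟩
      exact ⟨hz1, hz2⟩
    exact contDiffOn_const.prodMk (contDiffOn_const.prodMk
      (hA'.clm_apply (contDiffOn_snd.comp contDiffOn_snd fun z _ ↦ mem_univ _)))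
  set Φ : P × ℝ × W → ℝ → P × ℝ × W :=
    fun z s ↦ (z.1, z.2.1 + s, v z.1 z.2.1 z.2.2 (z.2.1 + s)) with hΦ_def
  set Vz : Set (P × ℝ × W) := U ×ˢ (Ioo (-δ) δ ×ˢ univ) with hVz_def
  have hVz : IsOpen Vz := hU.prod (isOpen_Ioo.prod isOpen_univ)
  have h0 : ∀ z ∈ Vz, Φ z 0 = z := by
    rintro ⟨p, τ₀, w⟩ ⟨hp, -, -⟩
    simp only [hΦ_def, add_zero, hv0 p hp τ₀ w]
  have hd : ∀ z ∈ Vz, ∀ s ∈ Ioo (-T') T', HasDerivAt (Φ z) (f (Φ z s)) s := by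
    rintro ⟨p, τ₀, w⟩ ⟨hp, hτ₀, -⟩ s hs
    have hclock : τ₀ + s ∈ Ioo (-S) S := by
      rcases hτ₀ with ⟨h1, h2⟩; rcases hs with ⟨h3, h4⟩
      constructor <;> rw [hS_def] <;> linarith
    have hvd : HasDerivAt (fun s' ↦ v p τ₀ w (τ₀ + s')) (A p (τ₀ + s) (v p τ₀ w (τ₀ + s))) s := by
      have h := hv p hp τ₀ w (τ₀ + s) hclock
      simpa using h.comp_const_add τ₀ s
    have hclockd : HasDerivAt (fun s' : ℝ ↦ τ₀ + s') 1 s := by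
      simpa using (hasDerivAt_id s).const_add τ₀
    exact (hasDerivAt_const s p).prodMk (hclockd.prodMk hvd)
  have hUm : ∀ z ∈ Vz, ∀ s ∈ Ioo (-T') T', Φ z s ∈ Uz := by
    rintro ⟨p, τ₀, w⟩ ⟨hp, hτ₀, -⟩ s hs
    refine ⟨hp, ⟨?_, ?_⟩, mem_univ _⟩
    · rcases hτ₀ with ⟨h1, -⟩; rcases hs with ⟨h3, -⟩
      show -T < τ₀ + s
      rw [hδ] at h1; linarith
    · rcases hτ₀ with ⟨-, h2⟩; rcases hs with ⟨-, h4⟩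
      show τ₀ + s < T
      rw [hδ] at h2; linarith
  have hflow := contDiffOn_flow_of_hasDerivAt_withTop hUz hf hn hVz h0 hd hUm
  -- the solution family and its properties
  refine ⟨fun p t ↦ v p 0 w₀ t, fun p hp ↦ hv0 p hp 0 w₀, fun p hp t ht ↦ ?_, ?_⟩
  · exact hv p hp 0 w₀ t ⟨by rcases ht with ⟨h, -⟩; rw [hS_def]; linarith,
      by rcases ht with ⟨-, h⟩; rw [hS_def]; linarith⟩
  · -- `(p, t) ↦ u p t` is the `W`-component of the flow at the initial point `(p, 0, w₀)`
    have hinner : ContDiffOn ℝ n (fun q : P × ℝ ↦ (((q.1, (0 : ℝ), w₀) : P × ℝ × W), q.2))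
        (U ×ˢ Ioo (-T') T') :=
      (contDiffOn_fst.prodMk (contDiffOn_const.prodMk contDiffOn_const)).prodMk contDiffOn_snd
    have hmaps : MapsTo (fun q : P × ℝ ↦ (((q.1, (0 : ℝ), w₀) : P × ℝ × W), q.2))
        (U ×ˢ Ioo (-T') T') (Vz ×ˢ Ioo (-T') T') := fun q hq ↦
      ⟨⟨hq.1, ⟨by linarith, hδ0⟩, mem_univ _⟩, hq.2⟩
    have hcomp := (hflow.comp hinner hmaps).snd.snd
    refine hcomp.congr fun q _ ↦ ?_
    simp only [hΦ_def, Function.comp_apply, zero_add]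

/-- **Real-analytic dependence on time and parameters for linear equations** (Poincaré;
Lang 1995, Ch. IV §1, Thm. 1.14/1.16 at `p = ω`): if
`(p, t) ↦ A p t ∈ L(W, W)` is real-analytic on `U × (-T, T)` (`U` open in a Banach space `P`),
then for every `0 < T' < T` and `w₀` the solutions `u p` of `u' = A(p, t) u`, `u p 0 = w₀`, exist on
`(-T', T')` for all `p ∈ U` and `(p, t) ↦ u p t` is real-analytic on `U × (-T', T')`.
[cite: Lang1995, Ch. IV §1, Thm. 1.14 and Thm. 1.16] -/
theorem exists_analyticOnNhd_linearODE_param [CompleteSpace P]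
    {A : P → ℝ → W →L[ℝ] W} {U : Set P} (hU : IsOpen U) {T T' : ℝ} (hT' : 0 < T')
    (hTT : T' < T) (hA : AnalyticOnNhd ℝ (fun q : P × ℝ ↦ A q.1 q.2) (U ×ˢ Ioo (-T) T))
    (w₀ : W) :
    ∃ u : P → ℝ → W, (∀ p ∈ U, u p 0 = w₀) ∧
      (∀ p ∈ U, ∀ t ∈ Ioo (-T') T', HasDerivAt (u p) (A p t (u p t)) t) ∧
      AnalyticOnNhd ℝ (fun q : P × ℝ ↦ u q.1 q.2) (U ×ˢ Ioo (-T') T') := by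
  obtain ⟨u, h0, hd, hs⟩ := exists_contDiffOn_linearODE_param_withTop (n := ω) le_top hU hT' hTT
    hA.contDiffOn_of_completeSpace w₀
  exact ⟨u, h0, hd, analyticOnNhd_of_contDiffOn_omega (hU.prod isOpen_Ioo) hs⟩

end Linear

end Literature.Analysis.ODE

end
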